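import Summits.NavierStokesRegularity.NavierStokesRegularity.Theses.AdaptedFrequency
import Summits.NavierStokesRegularity.NavierStokesRegularity.Theses.RecurrentProfiles
import Summits.NavierStokesRegularity.NavierStokesRegularity.Theorems.AdaptedFrequencyAdaptedFrequencyConvergesStubRecurrentPinchedBridgeGradLedger
import Summits.NavierStokesRegularity.NavierStokesRegularity.Theorems.AdaptedFrequencyAdaptedFrequencyConvergesStubRecurrentPinchedBridgeL3
import Summits.NavierStokesRegularity.NavierStokesRegularity.Theorems.SqueezeCycleSingularProfileOfNontrivial
import Summits.NavierStokesRegularity.NavierStokesRegularity.Theorems.RecurrentProfilesRecurrentRegularIsTrivial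
import Literature.Analysis.FluidPDE.AdaptedBackwardKernel
import Literature.Analysis.FluidPDE.TypeIAncientMild
import Literature.Analysis.FluidPDE.LocalTypeI
import Literature.Analysis.FluidPDE.SuitableWeak
import Literature.Analysis.FluidPDE.SelfSimilar
import Literature.Analysis.FluidPDE.VorticityCalculus

/-!
# Crux `AdaptedFrequencyConverges` (stmt-NavierStokesRegularity-10493), line `birkhoff-recurrent-hull`:
# stub `stub_recurrentPinchedBridge`

Theorems file (`--supports stmt-NavierStokesRegularity-10493`) proving the registered stub
`stub_recurrentPinchedBridge` of the skeleton
`Cruxes/AdaptedFrequencyConverges/Lines/birkhoff_recurrent_hull.lean` with exactly its signature: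
a uniformly recurrent (parabolic scaling about `(0,0)`, `C⁰` on compact cylinders) PINCHED
unit-viscosity Type-I ancient mild pair `(W, K)` — `W ∈ A_{C₀}` (`IsTypeIAncientMild C₀ W`), `K`
its Gaussian-comparable adapted backward kernel with pole `(0,0)`,
`0 < c ≤ (−τ)²·adaptedEnstrophy W K τ ≤ C'` — satisfies the hypothesis list of the item
`RecurrentProfiles.RecurrentLiouville` (stmt-NavierStokesRegularity-1589) together with a backward
singular origin:

* (i)–(ii) `W` is a suitable weak solution on the slab `ℝ³ × (−∞, 0)` for one classical pressure
  `q` (`exists_isClassicalNSSolutionOn_Iio_of_isTypeIAncientMild`), with weak gradient `∇W` and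
  `𝐈(ℝ³ × ℝ₋) < ∞` (`squeezeCycle_slabProfile_of_modelClass`), once `W` is placed in the model class
  `𝒦_{C₁}`: the velocity ledger is the PROVED crux `FarPastLedger` (`FarPastLedger_proof`,
  stmt-14060) and the gradient ledger is `farPast_gradLedger` (helper file
  `…StubRecurrentPinchedBridgeGradLedger`: local energy identity with the dissipation kept), with the
  Type-I constant enlarged to `C₁ = max(C₀, K_A, K_E)` (the class is monotone in `C`);
* (iii) the Type-I rate `HasTypeITimeDecay C₀ W` is a field of the class;
* (iv) `L³_loc({t ≤ 0} × ℝ³)` scaling-recurrence (`l3Recurrence_of_supRecurrence`, helper file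
  `…StubRecurrentPinchedBridgeL3`): on a compact
  `K₁ ⊆ {t ≤ 0}` split at `t = −δ`; below, the `C⁰` recurrence of the velocity on a large cylinder;
  on the thin final slab `(−δ, 0) × B_R` BOTH `W` and `W_l = nsRescale l W ∈ A_{C₀}` obey the
  class-uniform bound `∫∫ ‖u‖³ ≤ 2 C₀ K_A R √δ` (rate × ledger, `lintegral_thinSlab_le`); scales
  `l ∈ [a', L a']` become `σ = log l ∈ [a, a + log L]`;
* (v) the origin is backward singular: otherwise the PROVED item `RecurrentRegularIsTrivial`
  (stmt-1592, `recurrentRegularIsTrivial_proof`) and (iv) make `W` vanish a.e. on the slab, hence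
  everywhere on `t < 0` by continuity, so `adaptedEnstrophy W K (−1) = 0 < c` — contradiction.

References: D. Albritton, T. Barker, arXiv:1811.00502, §1–3, Rem. 3.2 [AlbrittonBarker2019];
G. Koch, N. Nadirashvili, G. Seregin, V. Šverák, Acta Math. 203 (2009) §4 [KochNadirashviliSereginSverak2009];
H. Furstenberg, *Recurrence in ergodic theory and combinatorial number theory* (1981), Def. 1.8 [Furstenberg1981].
-/

noncomputable section

open MeasureTheory Set Filter Metric Topology Function
open Literature.Analysis.FluidPDE
open scoped ENNReal NNReal

-- the summit and its single problem share the name (D-0017 nested layout)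
set_option linter.dupNamespace false

namespace Summit.NavierStokesRegularity.NavierStokesRegularity.Theorems.AdaptedFrequencyConverges.BirkhoffRecurrentHull

open Summit.NavierStokesRegularity.NavierStokesRegularity.Theorems

/-! ### The stub -/

/-- **Stub 2 of line `birkhoff-recurrent-hull` — the bridge: a uniformly recurrent pinched mild pair
is a recurrent local-energy Type-I profile, singular at the origin.** For `(W, K)` pinched and
uniformly recurrent (pair, `C⁰`): (i) `W` is a suitable weak solution on the slab with one classical
pressure and weak gradient `∇W`; (ii) `𝐈(ℝ³ × ℝ₋) < ∞`, `W` being a member of the model class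
`𝒦_{C₁}`, `C₁ = max(C₀, K_A, K_E)`: velocity ledger `FarPastLedger_proof` (stmt-14060), gradient
ledger `farPast_gradLedger` (local energy identity, dissipation kept), monotonicity of the class in
`C`, `squeezeCycle_slabProfile_of_modelClass`; (iii) the Type-I rate is a field of the class; (iv) the
`L³_loc({t ≤ 0})`-recurrence from the `C⁰` recurrence of the velocity
(`l3Recurrence_of_supRecurrence`); (v) the origin is backward singular: otherwise
`recurrentRegularIsTrivial_proof` (stmt-1592) and (iv) give `W = 0` a.e. on the slab, hence on all
of `t < 0` by continuity, so `adaptedEnstrophy W K (−1) = 0`, contradicting `0 < c ≤ h̄(−1)`.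
[cite: AlbrittonBarker2019, Lemma 2.6, Rem. 3.2 and §3; KochNadirashviliSereginSverak2009 §4] -/
theorem stub_recurrentPinchedBridge :
    ∀ (C₀ c C' : ℝ) (W : ℝ → EuclideanSpace ℝ (Fin 3) → EuclideanSpace ℝ (Fin 3))
      (K : ℝ → EuclideanSpace ℝ (Fin 3) → ℝ), 0 ≤ C₀ → 0 < c → IsTypeIAncientMild C₀ W →
      IsAdaptedBackwardKernel 1 W (Iio 0) 0 0 K → IsGaussianComparable K (Iio 0) 0 0 →
      (∀ K' : ℝ → EuclideanSpace ℝ (Fin 3) → ℝ, IsAdaptedBackwardKernel 1 W (Iio 0) 0 0 K' →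
        IsGaussianComparable K' (Iio 0) 0 0 → ∀ t ∈ Iio (0:ℝ), K' t = K t) →
      (∀ τ ∈ Iio (0:ℝ), c ≤ (-τ) ^ 2 * adaptedEnstrophy W K τ ∧ (-τ) ^ 2 * adaptedEnstrophy W K τ ≤ C') →
      (∀ ε : ℝ, 0 < ε → ∀ R : ℝ, 1 < R → ∃ L : ℝ, 1 < L ∧ ∀ a : ℝ, 0 < a → ∃ l : ℝ, a ≤ l ∧ l ≤ L * a ∧
        ∀ (t : ℝ) (x : EuclideanSpace ℝ (Fin 3)), -R ≤ t → t ≤ -R⁻¹ → ‖x‖ ≤ R →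
          ‖nsRescale l W t x - W t x‖ ≤ ε ∧ |l ^ 3 * K (l ^ 2 * t) (l • x) - K t x| ≤ ε) →
      ∃ (p : ℝ → EuclideanSpace ℝ (Fin 3) → ℝ) (G : ℝ → EuclideanSpace ℝ (Fin 3) → EuclideanSpace ℝ (Fin 3) →L[ℝ] EuclideanSpace ℝ (Fin 3)) (C : ℝ),
        IsSuitableWeakSolutionOn (slab (EuclideanSpace ℝ (Fin 3)) (Set.Iio 0) isOpen_Iio) 1 0 W p ∧
        HasWeakSpatialGradientOn (slab (EuclideanSpace ℝ (Fin 3)) (Set.Iio 0) isOpen_Iio) W G ∧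
        typeIBound (Set.Iio (0 : ℝ) ×ˢ Set.univ) W p G < ⊤ ∧ HasTypeITimeDecay C W ∧
        (∀ ε : ℝ, 0 < ε → ∀ K₁ : Set (ℝ × EuclideanSpace ℝ (Fin 3)), IsCompact K₁ → K₁ ⊆ Set.Iic (0 : ℝ) ×ˢ Set.univ →
          ∃ L : ℝ, 0 < L ∧ ∀ a : ℝ, ∃ σ ∈ Set.Icc a (a + L),
            MeasureTheory.eLpNorm (fun z : ℝ × EuclideanSpace ℝ (Fin 3) => nsRescale (Real.exp σ) W z.1 z.2 - W z.1 z.2) 3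
              (MeasureTheory.volume.restrict K₁) ≤ ENNReal.ofReal ε) ∧
        IsBackwardSingularPoint W 0 := by
  intro C₀ c C' W K hC₀ hc hW hK hG huniq hpinch hrec
  -- (iv) the `L³_loc` recurrence (velocity part of the pair recurrence)
  have hL3 := l3Recurrence_of_supRecurrence C₀ W hW (fun ε hε R hR => by
    obtain ⟨L, hL1, hL⟩ := hrec ε hε R hR
    refine ⟨L, hL1, fun a ha => ?_⟩
    obtain ⟨l, h1, h2, h3⟩ := hL a ha
    exact ⟨l, h1, h2, fun t x ht1 ht2 hx => (h3 t x ht1 ht2 hx).1⟩)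
  -- (i)–(ii) the model class with the enlarged constant, pressure, suitability, `𝐈 < ∞`
  obtain ⟨KA, hKA⟩ := FarPastLedger_proof C₀
  obtain ⟨KE, hKE0, hKE⟩ := farPast_gradLedger C₀
  set C₁ : ℝ := max C₀ (max KA KE) with hC₁
  -- `A_{C₀} ⊆ A_{C₁}`: only the Type-I bound involves the constant (cf. the tree's
  -- `TargetNegative.HeadInfluxLawCostume.isTypeIAncientMild_of_le`)
  have hWC : IsTypeIAncientMild C₁ W :=
    ⟨hW.1, hW.2.1, hW.2.2.1, fun t ht x => (hW.norm_le ht x).trans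
      (div_le_div_of_nonneg_right (le_max_left _ _) (Real.sqrt_nonneg _))⟩
  have h5 : ∀ (x₀ : EuclideanSpace ℝ (Fin 3)) (t₀ r : ℝ), t₀ ≤ 0 → 0 < r →
      (∀ t, t₀ - r ^ 2 < t → t < t₀ → r⁻¹ * ∫ x in ball x₀ r, ‖W t x‖ ^ 2 ≤ C₁) ∧
        r⁻¹ * ∫ t in Ioo (t₀ - r ^ 2) t₀, ∫ x in ball x₀ r, ‖fderiv ℝ (W t) x‖ ^ 2 ≤ C₁ := by
    intro x₀ t₀ r ht₀ hr
    refine ⟨fun t _ ht => ?_,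
      (hKE W hW x₀ t₀ r ht₀ hr).trans ((le_max_right _ _).trans (le_max_right _ _))⟩
    have htn : t < 0 := lt_of_lt_of_le ht ht₀
    rw [inv_mul_le_iff₀ hr]
    calc ∫ x in ball x₀ r, ‖W t x‖ ^ 2 ≤ KA * r := hKA W hW t htn x₀ r hr
      _ ≤ C₁ * r :=
          mul_le_mul_of_nonneg_right ((le_max_left _ _).trans (le_max_right _ _)) hr.le
      _ = r * C₁ := mul_comm _ _
  obtain ⟨q, hq⟩ := exists_isClassicalNSSolutionOn_Iio_of_isTypeIAncientMild hWC
  obtain ⟨hsw, hwg, hI⟩ := squeezeCycle_slabProfile_of_modelClass hWC h5 hq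
  -- (v) the origin is a backward singular point
  have hsing : IsBackwardSingularPoint W 0 := by
    by_contra hns
    have hloc : LocallyIntegrableOn (uncurry W)
        (Iio (0 : ℝ) ×ˢ (univ : Set (EuclideanSpace ℝ (Fin 3)))) volume :=
      hW.continuousOn_uncurry.locallyIntegrableOn (measurableSet_Iio.prod MeasurableSet.univ)
    have hae : uncurry W =ᵐ[volume.restrict (Iio (0 : ℝ) ×ˢ (univ : Set (EuclideanSpace ℝ (Fin 3))))] 0 :=
      recurrentRegularIsTrivial_proof W hloc hL3 hns
    have hzero : ∀ x : EuclideanSpace ℝ (Fin 3), W (-1) x = 0 := fun x => by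
      by_contra hx
      exact ApexLocalisation.Negative.not_ae_eq_zero_of_continuousOn_slab hW.continuousOn_uncurry
        (by norm_num) hx hae
    have hW1 : W (-1) = fun _ => (0 : EuclideanSpace ℝ (Fin 3)) := funext hzero
    have hH : adaptedEnstrophy W K (-1) = 0 := by
      unfold adaptedEnstrophy
      rw [hW1]
      simp [curl_fun_zero]
    have h1 := (hpinch (-1) (by norm_num)).1
    rw [hH, mul_zero] at h1
    linarith
  exact ⟨q, fun t x => fderiv ℝ (W t) x, C₀, hsw, hwg, hI, hW.hasTypeITimeDecay, hL3, hsing⟩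

end Summit.NavierStokesRegularity.NavierStokesRegularity.Theorems.AdaptedFrequencyConverges.BirkhoffRecurrentHull

end
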